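import Literature.MathematicalPhysics.QuantumLattice.GaugedHubbardTorus
import Literature.MathematicalPhysics.QuantumLattice.LTQO
import Literature.MathematicalPhysics.QuantumLattice.FermionLiebRobinson
import Literature.MathematicalPhysics.QuantumLattice.SpinSystemProofs
import Literature.MathematicalPhysics.QuantumLattice.FinDimSpectrumClusterGapProofs
import HarnessLib

/-!
# Local indistinguishability (LTQO) for the physical gauged Hubbard torus

Trunk T-QLATTICE (family `hubbard`; requested by route `EatTheGoldstone`, support item
`GaugedLTQO` = clause (b) of the crux `GaugedZ2TopologicalOrder`). The vocabulary in which
"no local, gauge-invariant observable distinguishes the `m` quasi-degenerate ground states of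
`gaugedHubbardTorusPhys L U e M ρ`" is stated, modelled on the spin-system `HasLTQO` /
`localGroundProj` of `LTQO.lean` and on Bravyi–Hastings–Michalakis' condition TQO-1
("`P O_A P = c P` for every operator `O_A` acting on a square `A` of size `≤ L*`", BHM10 §2.2;
Bravyi–Hastings 2011 §2), here for a degenerate CLUSTER of a fermion ⊗ link system compressed
to its Gauss-law sector. All objects are finite matrices; every definition has a body.

* **Cluster projections** (general finite-dimensional spectral bookkeeping). Mathlib lists the
  eigenvalues of a Hermitian matrix in DECREASING order along the fixed equivalence
  `Fin (card n) ≃ n` (`Matrix.IsHermitian.eigenvalues₀_antitone`); `eigenOrder n` is the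
  increasing re-enumeration, `lowIndices n m` the indices of the `m` LOWEST eigenvalues (counted
  with multiplicity), `hA.clusterSpace m` the span of the corresponding eigenvectors of
  `Matrix.IsHermitian.eigenvectorBasis` (= the columns of `Matrix.IsHermitian.eigenvectorUnitary`,
  `eigenvectorUnitary_col_eq`), and `hA.clusterProj m = projMatrix (hA.clusterSpace m)` its
  orthogonal projection; `Matrix.clusterProj A m` is the total version (junk `0` for non-Hermitian
  `A`). API: `card_lowIndices = min (card n) m`, the cluster carries the lowest eigenvalues
  (`eigenvalues_le_of_mem_lowIndices`), `P` is a Hermitian idempotent of norm `≤ 1` acting as the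
  indicator of the cluster on the eigenbasis (`clusterProj_mulVec_eigenvectorBasis`), and
  **under a cluster gap `A.HasClusterGap m w Δ` the count-cluster IS the energy window**
  `{i | λᵢ ≤ E₀ + w}` (`lowIndices_eq_filter_of_hasClusterGap`), so that `clusterProj` is then the
  spectral projection `𝟙_{(-∞, E₀ + w]}(A)` of Michalakis–Zwolak's `P_B(ε)` type (MZ13 Def. 3).
* **Supports** in the coupled system `Index L M = occupations × fluxes`: the *local gauge–matter
  algebra* `GaugedHubbard.localAlgebra M B` of a set of sites `B` is the subalgebra generated by
  the Kronecker products `a ⊗ₖ l` with `a` an EVEN Jordan–Wigner polynomial in the orbitals over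
  `B` (`carEvenSubalgebra (orbSet B)`, Bratteli–Robinson II §5.2.2, as in
  `FermionLiebRobinson.lean`) and `l` a link operator supported on the bonds with both endpoints
  in `B` (`IsSupportedOn` of `SpinSystem.lean` on `bondsIn B`); `GaugedHubbard.IsSupportedOn O B`
  is membership. Fermionic LTQO is only ever asked of even observables (Nachtergaele–Sims–Young
  2018 §2, §6).
* **Gauge invariance** `GaugedHubbard.IsGaugeInvariant ρ O`: `O` commutes with every Gauss
  generator `gaussGenerator L M ρ y`; equivalently it is neutral for every Gauss-charge grading
  (`isGaugeInvariant_iff_hasShift`), hence maps the Gauss-law sector into itself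
  (`IsGaugeInvariant.apply_eq_zero`). With a local gauge symmetry only such observables need to
  satisfy LTQO (Nachtergaele–Sims–Young 2024, remark after Assumption 2.3).
* **Compression** `GaugedHubbard.toPhys ρ O` of an operator to the physical block
  `{ik // IsPhysical ρ ik}` (Gauss law and `2S^z = 0`), so that
  `toPhys ρ (gaugedHubbardTorus L U e M) = gaugedHubbardTorusPhys L U e M ρ` (`rfl`); it is a
  contraction (`norm_toPhys_le`) and multiplicative against block-preserving operators
  (`toPhys_mul_of_apply_eq_zero`). Supports are defined BEFORE compression (the physical block is
  not a tensor product).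
* **`GaugedHubbard.HasLTQO L U e M ρ m Δ`**: for every site `x`, radii `r, ℓ` with `2 (r + ℓ) < L`
  and every gauge-invariant `O` supported in the ball `siteBall x r` (torus distance `≤ r`) there is
  `c : ℂ` with `‖P Oₚ P − c • P‖ ≤ ‖O‖ Δ ℓ`, `Oₚ = toPhys ρ O`,
  `P = clusterProj (gaugedHubbardTorusPhys L U e M ρ) m`. This is TQO-1 of BHM10 for the global
  `m`-cluster with an explicit error `Δ ℓ` governed by the room `ℓ` left before the ball wraps
  around the torus (exact TQO-1 is `Δ = 0`); the scalar is existential rather than MZ13's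
  `c(O) = tr (P O) / tr P` (`ltqoConst`) — the two forms agree up to a factor `2` in `Δ`
  (`HasLTQO.of_ltqoConst`). The rate `Δ ≡ 1` always works (`hasLTQO_const_one`): the content is
  in DECAYING rates (`IsDecaying`, `HasFastDecay` of `LTQO.lean`).

## Sources

S. Bravyi, M. B. Hastings, S. Michalakis, J. Math. Phys. **51** (2010) 093512 = arXiv:1001.0344,
§2.2 (TQO-1, TQO-2) ["BHM10"]; S. Bravyi, M. B. Hastings, CMP **307** (2011) 609 =
arXiv:1001.4363, §2 (TQO-1/2, Corollary 1: `P_C O_A P_C = c P_C`); S. Michalakis, J. P. Zwolak,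
CMP **322** (2013) 277 = arXiv:1109.1588, §4 Definition 3 (`P_B(ε)`), §4.1 Definition 4
(Local-TQO) ["MZ13"]; B. Nachtergaele, R. Sims, A. Young, Contemp. Math. **717** (2018) 93 =
arXiv:1705.08553, §2 (even observables `𝒜⁺`) and §6 (symmetry-restricted LTQO); Lett. Math.
Phys. **114** (2024) 24 = arXiv:2102.07209, Assumption 2.3 (LTQO) and the remark following it
(local gauge symmetry: only commuting observables); T. H. Hansson, V. Oganesyan, S. L. Sondhi,
Ann. Phys. **313** (2004) 497, §4 (topological order of gauged superconductors).

## Design notes, junk values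

* `lowIndices`, `eigenOrder` depend only on the index type: WHICH indices carry the `m` lowest
  eigenvalues is fixed by Mathlib's indexing convention (`eigenvalues i = eigenvalues₀ (e.symm i)`),
  the eigenvalues/eigenvectors themselves come with `hA`.
* Ties: if the `m`-th and `(m+1)`-st lowest eigenvalues coincide, `clusterSpace` depends on
  Mathlib's auxiliary choice of `eigenvectorBasis` inside that eigenspace (it is still an
  `A`-invariant rank-`m` space of lowest-energy vectors); under `HasClusterGap A m w Δ` there is no
  tie across the boundary and the cluster is canonical (`lowIndices_eq_filter_of_hasClusterGap`).
  `m ≥ card n`: `lowIndices = univ` (`lowIndices_of_card_le`), `P` projects onto everything;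
  `m = 0`: `lowIndices = ∅`. Non-Hermitian `A`: `Matrix.clusterProj A m = 0`.
* `Matrix.clusterProj`, `Matrix.IsHermitian.clusterSpace/clusterProj` (and their lemmas) are
  deliberate dot-notation extensions of Mathlib's `Matrix` namespace, as `Matrix.HasClusterGap`,
  `Matrix.groundProj` of `FinDimSpectrum.lean`; everything else lives in
  `Literature.MathematicalPhysics.QuantumLattice[.GaugedHubbard]`.
* Not here: any CLAIM that the gauged Hubbard torus has LTQO with a decaying rate (that is the
  route's support item, a thesis, not literature); Wilson-line sector labels; the `M → ∞` and
  `e → 0` limits.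
-/

noncomputable section

open Matrix Finset
open scoped Matrix.Norms.L2Operator Kronecker

namespace Literature.MathematicalPhysics.QuantumLattice

/-! ### Increasing enumeration of eigen-indices and the low cluster -/

section EigenOrder

variable {n : Type*} [Fintype n]

/-- The increasing enumeration `Fin (card n) ≃ n` of the indices of a Hermitian matrix's
eigenvalues: Mathlib's fixed equivalence `Fintype.equivOfCardEq (Fintype.card_fin _)` (along which
`Matrix.IsHermitian.eigenvalues` is DECREASING, `eigenvalues₀_antitone`) composed with `Fin.rev`,
so that `k ↦ λ (eigenOrder n k)` is monotone (`monotone_eigenvalues_comp_eigenOrder`). [folklore] -/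
def eigenOrder (n : Type*) [Fintype n] : Fin (Fintype.card n) ≃ n :=
  Fin.revPerm.trans (Fintype.equivOfCardEq (Fintype.card_fin _))

/-- The indices of the `m` lowest eigenvalues (counted with multiplicity; all of them if
`card n ≤ m`): positions `< m` in the increasing enumeration `eigenOrder`. MZ13 §4 Def. 3 (the
low-energy cluster); BHM10 §2. [folklore] -/
def lowIndices (n : Type*) [Fintype n] (m : ℕ) : Finset n :=
  univ.filter fun i => ((eigenOrder n).symm i : ℕ) < m

/-- Membership in the low cluster. [folklore] -/
theorem mem_lowIndices_iff {m : ℕ} {i : n} :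
    i ∈ lowIndices n m ↔ ((eigenOrder n).symm i : ℕ) < m := by
  simp [lowIndices]

/-- The low cluster is the image of `{k : Fin (card n) | k < m}` under `eigenOrder`. [folklore] -/
theorem lowIndices_eq_map (m : ℕ) :
    lowIndices n m = (univ.filter fun k : Fin (Fintype.card n) => (k : ℕ) < m).map
      (eigenOrder n).toEmbedding := by
  ext i
  simp [lowIndices, Finset.mem_map_equiv]

/-- **The low cluster has `min (card n) m` elements.** [folklore] -/
theorem card_lowIndices (m : ℕ) : (lowIndices n m).card = min (Fintype.card n) m := by
  rw [lowIndices_eq_map, card_map, Fin.card_filter_val_lt]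

/-- `m = 0`: the low cluster is empty. [folklore] -/
@[simp] theorem lowIndices_zero : lowIndices n 0 = ∅ := by
  ext i
  simp [lowIndices]

/-- `card n ≤ m`: the low cluster is everything (documented junk case of `clusterProj`).
[folklore] -/
theorem lowIndices_of_card_le {m : ℕ} (h : Fintype.card n ≤ m) : lowIndices n m = univ := by
  ext i
  simp only [mem_lowIndices_iff, mem_univ, iff_true]
  exact lt_of_lt_of_le ((eigenOrder n).symm i).isLt h

/-- The low clusters are nested. [folklore] -/
theorem lowIndices_mono {m m' : ℕ} (h : m ≤ m') : lowIndices n m ⊆ lowIndices n m' :=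
  fun _ hi => mem_lowIndices_iff.2 (lt_of_lt_of_le (mem_lowIndices_iff.1 hi) h)

variable [DecidableEq n] {A : Matrix n n ℂ}

/-- Along `eigenOrder` the eigenvalues are the decreasing list `eigenvalues₀` read backwards.
[folklore] -/
theorem eigenvalues_eigenOrder (hA : A.IsHermitian) (k : Fin (Fintype.card n)) :
    hA.eigenvalues (eigenOrder n k) = hA.eigenvalues₀ k.rev := by
  simp [Matrix.IsHermitian.eigenvalues, eigenOrder]

/-- **`eigenOrder` enumerates the eigenvalues increasingly.** [folklore] -/
theorem monotone_eigenvalues_comp_eigenOrder (hA : A.IsHermitian) :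
    Monotone (hA.eigenvalues ∘ eigenOrder n) := fun k l hkl => by
  simp only [Function.comp_apply, eigenvalues_eigenOrder]
  exact hA.eigenvalues₀_antitone (Fin.rev_le_rev.2 hkl)

/-- **The low cluster carries the lowest eigenvalues**: `λᵢ ≤ λⱼ` for `i ∈ lowIndices n m ∌ j`.
MZ13 §4 Def. 3; BHM10 §2. [folklore] -/
theorem eigenvalues_le_of_mem_lowIndices (hA : A.IsHermitian) {m : ℕ} {i j : n}
    (hi : i ∈ lowIndices n m) (hj : j ∉ lowIndices n m) : hA.eigenvalues i ≤ hA.eigenvalues j := by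
  rw [mem_lowIndices_iff] at hi hj
  have hk : (eigenOrder n).symm i ≤ (eigenOrder n).symm j := Fin.le_def.2 (by omega)
  simpa using monotone_eigenvalues_comp_eigenOrder hA hk

/-- **Under a cluster gap the count-cluster is the energy window.** If `A.HasClusterGap m w Δ`
(exactly `m` eigenvalues in `[E₀, E₀ + w]`, all others `≥ E₀ + w + Δ`), then the indices of the
`m` lowest eigenvalues are exactly those with `λᵢ ≤ E₀ + w`; in particular `clusterProj` is then
the spectral projection of the window, Michalakis–Zwolak's `P(ε)` (MZ13 §4 Def. 3, Cor. 1 (4)).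
[folklore] -/
theorem lowIndices_eq_filter_of_hasClusterGap {m : ℕ} {w Δ : ℝ} (h : A.HasClusterGap m w Δ) :
    lowIndices n m = univ.filter fun i =>
      h.isHermitian.eigenvalues i ≤ (⨅ j, h.isHermitian.eigenvalues j) + w := by
  obtain ⟨hA, -, hΔ, hcard, hsep⟩ := h
  set W : Finset n := univ.filter fun i => hA.eigenvalues i ≤ (⨅ j, hA.eigenvalues j) + w with hW
  have hmW : W.card = m := hcard
  have hm : m ≤ Fintype.card n := hmW ▸ card_le_univ W
  have hcardL : (lowIndices n m).card = m := by rw [card_lowIndices, min_eq_right hm]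
  -- either the low cluster lies in the window, or the window lies in the low cluster
  by_cases hsub : lowIndices n m ⊆ W
  · exact eq_of_subset_of_card_le hsub (by rw [hmW, hcardL])
  · obtain ⟨j, hjL, hjW⟩ := not_subset.1 hsub
    have hjgt : (⨅ k, hA.eigenvalues k) + w < hA.eigenvalues j := by
      simpa [hW] using hjW
    have hWL : W ⊆ lowIndices n m := by
      intro i hiW
      by_contra hiL
      have h1 : hA.eigenvalues i ≤ (⨅ k, hA.eigenvalues k) + w := by simpa [hW] using hiW
      exact absurd (h1.trans_lt hjgt) (not_lt.2 (eigenvalues_le_of_mem_lowIndices hA hjL hiL))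
    exact (eq_of_subset_of_card_le hWL (by rw [hmW, hcardL])).symm

end EigenOrder

/-- The orthogonal projection matrices have operator norm `≤ 1`
(`Submodule.starProjection_norm_le`, transported along `Matrix.toEuclideanCLM`). [folklore] -/
theorem norm_projMatrix_le_one {n : Type*} [Fintype n] [DecidableEq n]
    (K : Submodule ℂ (EuclideanSpace ℂ n)) : ‖projMatrix K‖ ≤ 1 := by
  rw [Matrix.cstar_norm_def, projMatrix, StarAlgEquiv.apply_symm_apply]
  exact K.starProjection_norm_le

end Literature.MathematicalPhysics.QuantumLattice

/-! ### Cluster projections (dot-notation extensions of Mathlib's `Matrix`) -/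

namespace Matrix

open Literature.MathematicalPhysics.QuantumLattice

variable {n : Type*} [Fintype n] [DecidableEq n] {A : Matrix n n ℂ}

/-- (Dot-notation extension of Mathlib's `Matrix.IsHermitian`.) The *cluster space* of the `m`
lowest eigenvalues of a Hermitian matrix: the span of the eigenvectors `uᵢ = hA.eigenvectorBasis i`
(the columns of `hA.eigenvectorUnitary`), `i ∈ lowIndices n m`. See the module docstring for
ties and `m ≥ card n`. MZ13 §4 Def. 3; BHM10 §2 (the ground subspace `P`). [folklore] -/
def IsHermitian.clusterSpace (hA : A.IsHermitian) (m : ℕ) : Submodule ℂ (EuclideanSpace ℂ n) :=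
  Submodule.span ℂ (Set.range fun i : lowIndices n m => hA.eigenvectorBasis i)

/-- (Dot-notation extension of Mathlib's `Matrix.IsHermitian`.) The *cluster projection*: the
orthogonal projection onto `hA.clusterSpace m`, as a matrix (`projMatrix`, i.e. Mathlib's
`Submodule.starProjection`), `P = Σ_{i ∈ lowIndices n m} |uᵢ⟩⟨uᵢ|`. MZ13 §4 Def. 3 (`P_B(ε)`,
`P₀`); BHM10 §2.2. [folklore] -/
def IsHermitian.clusterProj (hA : A.IsHermitian) (m : ℕ) : Matrix n n ℂ :=
  projMatrix (hA.clusterSpace m)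

open Classical in
/-- (Dot-notation extension of Mathlib's `Matrix`.) Total version of the cluster projection onto
the `m` lowest eigenvalues: `A.clusterProj m = hA.clusterProj m` for Hermitian `A`
(`clusterProj_eq`), **junk value `0`** otherwise. MZ13 §4 Def. 3; BHM10 §2.2. [folklore] -/
def clusterProj (A : Matrix n n ℂ) (m : ℕ) : Matrix n n ℂ :=
  if hA : A.IsHermitian then hA.clusterProj m else 0

/-- The total cluster projection of a Hermitian matrix. [folklore] -/
theorem clusterProj_eq (hA : A.IsHermitian) (m : ℕ) : A.clusterProj m = hA.clusterProj m := by
  rw [Matrix.clusterProj, dif_pos hA]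

/-- `dim clusterSpace = min (card n) m` (orthonormal vectors are independent). [folklore] -/
theorem IsHermitian.finrank_clusterSpace (hA : A.IsHermitian) (m : ℕ) :
    Module.finrank ℂ (hA.clusterSpace m) = min (Fintype.card n) m := by
  rw [IsHermitian.clusterSpace, finrank_eigSpan hA, card_lowIndices]

/-- The cluster projection is Hermitian. [folklore] -/
theorem IsHermitian.clusterProj_isHermitian (hA : A.IsHermitian) (m : ℕ) :
    (hA.clusterProj m).IsHermitian :=
  projMatrix_isHermitian _

/-- The cluster projection is idempotent. [folklore] -/
theorem IsHermitian.clusterProj_mul_self (hA : A.IsHermitian) (m : ℕ) :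
    hA.clusterProj m * hA.clusterProj m = hA.clusterProj m :=
  projMatrix_mul_self _

/-- `‖P‖ ≤ 1`. [folklore] -/
theorem IsHermitian.norm_clusterProj_le_one (hA : A.IsHermitian) (m : ℕ) :
    ‖hA.clusterProj m‖ ≤ 1 :=
  norm_projMatrix_le_one _

/-- **`P` is the indicator of the low cluster on the eigenbasis**: `P uₗ = uₗ` for
`l ∈ lowIndices n m` and `P uₗ = 0` otherwise (orthonormality). MZ13 §4 Def. 3. [folklore] -/
theorem IsHermitian.clusterProj_mulVec_eigenvectorBasis (hA : A.IsHermitian) (m : ℕ) (l : n) :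
    hA.clusterProj m *ᵥ (hA.eigenvectorBasis l : n → ℂ) =
      if l ∈ lowIndices n m then (hA.eigenvectorBasis l : n → ℂ) else 0 := by
  rw [IsHermitian.clusterProj, projMatrix_mulVec]
  split_ifs with hl
  · have hmem : (hA.eigenvectorBasis l : EuclideanSpace ℂ n) ∈ hA.clusterSpace m :=
      Submodule.subset_span ⟨⟨l, hl⟩, rfl⟩
    rw [Submodule.starProjection_eq_self_iff.mpr hmem]
  · have hmem : (hA.eigenvectorBasis l : EuclideanSpace ℂ n) ∈ (hA.clusterSpace m)ᗮ := by
      refine (Submodule.mem_orthogonal _ _).2 fun x hx => ?_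
      rw [inner_eq_zero_symm]
      exact inner_eigenvectorBasis_eq_zero_of_mem_eigSpan hA hx hl
    rw [(Submodule.starProjection_apply_eq_zero_iff _).mpr hmem, WithLp.ofLp_zero]

/-- `m = 0`: the cluster projection vanishes. [folklore] -/
theorem IsHermitian.clusterProj_zero (hA : A.IsHermitian) : hA.clusterProj 0 = 0 := by
  have h : hA.clusterSpace 0 = ⊥ := by
    rw [IsHermitian.clusterSpace, Submodule.span_eq_bot]
    rintro _ ⟨⟨i, hi⟩, rfl⟩
    simp at hi
  rw [IsHermitian.clusterProj, h, projMatrix, Submodule.starProjection_bot, map_zero]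

end Matrix

namespace Literature.MathematicalPhysics.QuantumLattice

open Literature.Probability.LatticeModels GaugedHubbard

namespace GaugedHubbard

/-! ### Balls, bonds and the local gauge–matter algebras -/

section Support

variable {L : ℕ} {M : ℕ}

/-- The ball of sites `B(x, r) = {y | torusDist x y ≤ r}` (periodic sup-norm distance of the
underlying torus sites) in the fermionic torus `(ℤ/Lℤ)²`. MZ13 §4 (balls `b_u(r)`). [folklore] -/
def siteBall (x : FermionTorus 2 L) (r : ℕ) : Finset (FermionTorus 2 L) :=
  univ.filter fun y => torusDist x.toTorusSite y.toTorusSite ≤ r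

/-- Membership in a ball of sites. [folklore] -/
@[simp] theorem mem_siteBall_iff {x y : FermionTorus 2 L} {r : ℕ} :
    y ∈ siteBall x r ↔ torusDist x.toTorusSite y.toTorusSite ≤ r := by
  simp [siteBall]

/-- Balls grow with the radius. [folklore] -/
theorem siteBall_mono (x : FermionTorus 2 L) {r r' : ℕ} (h : r ≤ r') :
    siteBall x r ⊆ siteBall x r' :=
  fun _ hy => mem_siteBall_iff.2 ((mem_siteBall_iff.1 hy).trans h)

variable [NeZero L]

/-- The bonds `b = (x, i)` (from `x` to `x + eᵢ`) with BOTH endpoints in `B`. [folklore] -/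
def bondsIn (B : Finset (FermionTorus 2 L)) : Finset (Bond L) :=
  univ.filter fun b => b.1 ∈ B ∧ b.1.shift b.2 ∈ B

/-- Membership in `bondsIn`. [folklore] -/
@[simp] theorem mem_bondsIn_iff {B : Finset (FermionTorus 2 L)} {b : Bond L} :
    b ∈ bondsIn B ↔ b.1 ∈ B ∧ b.1.shift b.2 ∈ B := by
  simp [bondsIn]

/-- `bondsIn` is monotone. [folklore] -/
theorem bondsIn_mono {B B' : Finset (FermionTorus 2 L)} (h : B ⊆ B') : bondsIn B ⊆ bondsIn B' :=
  fun _ hb => mem_bondsIn_iff.2 ⟨h (mem_bondsIn_iff.1 hb).1, h (mem_bondsIn_iff.1 hb).2⟩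

variable (M)

/-- The elementary local operators of the region `B`: Kronecker products `a ⊗ₖ l` of an EVEN
Jordan–Wigner polynomial `a` in the orbitals over `B` (`carEvenSubalgebra (orbSet B)`,
Bratteli–Robinson II §5.2.2) with a link operator `l` supported on the bonds inside `B`
(`IsSupportedOn` of `SpinSystem.lean`). NSY18 §2 (`𝒜⁺_X`); BHM10 §2. [folklore] -/
def localGenerators (B : Finset (FermionTorus 2 L)) : Set (Matrix (Index L M) (Index L M) ℂ) :=
  {O | ∃ a ∈ carEvenSubalgebra (orbSet B), ∃ l : Op (Bond L) (2 * M + 1),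
    QuantumLattice.IsSupportedOn l (bondsIn B) ∧ a ⊗ₖ l = O}

/-- **The local gauge–matter algebra `𝔄(B)`** of a set of sites `B` in the coupled system
`Index L M`: the subalgebra generated by the even fermion polynomials over `B` tensor the link
operators of the bonds inside `B` (`Algebra.adjoin` of `localGenerators`). Bratteli–Robinson II
§5.2.2, §6.2.1; NSY18 §2. [folklore] -/
def localAlgebra (B : Finset (FermionTorus 2 L)) : Subalgebra ℂ (Matrix (Index L M) (Index L M) ℂ) :=
  Algebra.adjoin ℂ (localGenerators M B)

variable {M}

/-- `O` is *supported on* the set of sites `B`: `O ∈ 𝔄(B)` (`localAlgebra`). The fermionic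
factor is automatically EVEN, as fermionic LTQO requires (NSY18 §6). [folklore] -/
def IsSupportedOn (O : Matrix (Index L M) (Index L M) ℂ) (B : Finset (FermionTorus 2 L)) : Prop :=
  O ∈ localAlgebra M B

/-- Unfolding `IsSupportedOn`. [folklore] -/
theorem isSupportedOn_iff {O : Matrix (Index L M) (Index L M) ℂ} {B : Finset (FermionTorus 2 L)} :
    IsSupportedOn O B ↔ O ∈ localAlgebra M B := Iff.rfl

/-- Elementary tensors `a ⊗ₖ l` are supported on `B`. [folklore] -/
theorem isSupportedOn_kronecker {B : Finset (FermionTorus 2 L)}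
    {a : Matrix (Finset (Orb (FermionTorus 2 L))) (Finset (Orb (FermionTorus 2 L))) ℂ}
    (ha : a ∈ carEvenSubalgebra (orbSet B)) {l : Op (Bond L) (2 * M + 1)}
    (hl : QuantumLattice.IsSupportedOn l (bondsIn B)) : IsSupportedOn (a ⊗ₖ l) B :=
  Algebra.subset_adjoin ⟨a, ha, l, hl, rfl⟩

/-- `𝔄(B)` contains `1`. [folklore] -/
theorem IsSupportedOn.one (B : Finset (FermionTorus 2 L)) :
    IsSupportedOn (1 : Matrix (Index L M) (Index L M) ℂ) B :=
  Subalgebra.one_mem _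

/-- `𝔄(B)` is closed under products. [folklore] -/
theorem IsSupportedOn.mul {O O' : Matrix (Index L M) (Index L M) ℂ} {B : Finset (FermionTorus 2 L)}
    (hO : IsSupportedOn O B) (hO' : IsSupportedOn O' B) : IsSupportedOn (O * O') B :=
  Subalgebra.mul_mem _ hO hO'

/-- `𝔄(B)` is closed under sums. [folklore] -/
theorem IsSupportedOn.add {O O' : Matrix (Index L M) (Index L M) ℂ} {B : Finset (FermionTorus 2 L)}
    (hO : IsSupportedOn O B) (hO' : IsSupportedOn O' B) : IsSupportedOn (O + O') B :=
  Subalgebra.add_mem _ hO hO'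

/-- `𝔄(B)` is closed under scalars. [folklore] -/
theorem IsSupportedOn.smul {O : Matrix (Index L M) (Index L M) ℂ} {B : Finset (FermionTorus 2 L)}
    (hO : IsSupportedOn O B) (c : ℂ) : IsSupportedOn (c • O) B :=
  Subalgebra.smul_mem _ hO c

/-- Isotony: `B ⊆ B' → 𝔄(B) ≤ 𝔄(B')`. Bratteli–Robinson II §6.2.1. [folklore] -/
theorem localAlgebra_mono {B B' : Finset (FermionTorus 2 L)} (h : B ⊆ B') :
    localAlgebra M B ≤ localAlgebra M B' := by
  refine Algebra.adjoin_mono ?_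
  rintro _ ⟨a, ha, l, hl, rfl⟩
  have hS : orbSet B ⊆ orbSet B' := fun k hk => mem_orbSet.2 (h (mem_orbSet.1 hk))
  exact ⟨a, carEvenSubalgebra_mono hS ha, l,
    QuantumLattice.IsSupportedOn.mono_holds hl (bondsIn_mono h), rfl⟩

/-- Isotony for supports. [folklore] -/
theorem IsSupportedOn.mono {O : Matrix (Index L M) (Index L M) ℂ} {B B' : Finset (FermionTorus 2 L)}
    (hO : IsSupportedOn O B) (h : B ⊆ B') : IsSupportedOn O B' :=
  localAlgebra_mono h hO

/-- The transporter `U_b` of a bond inside `B` is supported on the bonds inside `B`. [folklore] -/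
theorem linkRaise_isSupportedOn {B : Finset (FermionTorus 2 L)} {b : Bond L} (hb : b ∈ bondsIn B) :
    QuantumLattice.IsSupportedOn (linkRaise L M b) (bondsIn B) :=
  QuantumLattice.IsSupportedOn.mono_holds (isSupportedOn_onSite_holds b (raise M))
    (Finset.singleton_subset_iff.2 hb)

/-- Non-vacuity: the covariant hopping term `(c†_{xσ} c_{x+eᵢ,σ}) ⊗ U_{(x,i)}` of the
Hamiltonian is supported on every `B` containing `x` and `x + eᵢ`. [folklore] -/
theorem isSupportedOn_hopTerm {B : Finset (FermionTorus 2 L)} {x : FermionTorus 2 L} {i : Fin 2}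
    (hx : x ∈ B) (hxi : x.shift i ∈ B) (σ : Fin 2) :
    IsSupportedOn ((creation (orb x σ) * annihilation (orb (x.shift i) σ)) ⊗ₖ
      linkRaise L M (x, i)) B :=
  isSupportedOn_kronecker
    (creation_mul_annihilation_mem_carEvenSubalgebra (orb_mem_orbSet hx σ) (orb_mem_orbSet hxi σ))
    (linkRaise_isSupportedOn (mem_bondsIn_iff.2 ⟨hx, hxi⟩))

end Support

/-! ### Gauge-invariant operators -/

section Gauge

variable {L M : ℕ} [NeZero L]

/-- `O` is *gauge invariant* (for the background `ρ`): it commutes with every Gauss-law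
generator `G_y`. Bietenholz–Wiese (2025) §11.7 eq. (11.50); NSY24, remark after Assumption 2.3.
[folklore] -/
def IsGaugeInvariant (ρ : FermionTorus 2 L → ℤ) (O : Matrix (Index L M) (Index L M) ℂ) : Prop :=
  ∀ y, Commute (gaussGenerator L M ρ y) O

/-- **Gauge invariance = neutrality for every Gauss-charge grading** (`HasShift … 0`): the `G_y`
are diagonal with integer entries. Fradkin (2013) §9.11 eq. (9.80). [folklore] -/
theorem isGaugeInvariant_iff_hasShift {ρ : FermionTorus 2 L → ℤ}
    {O : Matrix (Index L M) (Index L M) ℂ} :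
    IsGaugeInvariant ρ O ↔ ∀ y, HasShift (gaussCharge L M ρ y) O 0 := by
  constructor
  · intro h y i j hij
    have hc := congrFun (congrFun (h y).eq i) j
    rw [gaussGenerator, diagonal_mul, mul_diagonal, mul_comm, ← sub_eq_zero, ← mul_sub,
      mul_eq_zero, sub_eq_zero, Int.cast_inj] at hc
    rw [hc.resolve_left hij, add_zero]
  · intro h y
    unfold gaussGenerator
    exact HasShift.commute_diagonal fun i j hij => by rw [h y i j hij, add_zero]

/-- The Hamiltonian `H_e` is gauge invariant (`commute_gaussGenerator_gaugedHubbardTorus`).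
Bietenholz–Wiese (2025) §11.7 eq. (11.50). [folklore] -/
theorem isGaugeInvariant_gaugedHubbardTorus (U e : ℝ) (ρ : FermionTorus 2 L → ℤ) :
    IsGaugeInvariant ρ (gaugedHubbardTorus L U e M) :=
  fun y => commute_gaussGenerator_gaugedHubbardTorus U e ρ y

/-- `1` is gauge invariant. [folklore] -/
theorem IsGaugeInvariant.one (ρ : FermionTorus 2 L → ℤ) :
    IsGaugeInvariant ρ (1 : Matrix (Index L M) (Index L M) ℂ) :=
  fun _ => Commute.one_right _

/-- Products of gauge-invariant operators are gauge invariant. [folklore] -/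
theorem IsGaugeInvariant.mul {ρ : FermionTorus 2 L → ℤ} {O O' : Matrix (Index L M) (Index L M) ℂ}
    (hO : IsGaugeInvariant ρ O) (hO' : IsGaugeInvariant ρ O') : IsGaugeInvariant ρ (O * O') :=
  fun y => (hO y).mul_right (hO' y)

/-- Sums of gauge-invariant operators are gauge invariant. [folklore] -/
theorem IsGaugeInvariant.add {ρ : FermionTorus 2 L → ℤ} {O O' : Matrix (Index L M) (Index L M) ℂ}
    (hO : IsGaugeInvariant ρ O) (hO' : IsGaugeInvariant ρ O') : IsGaugeInvariant ρ (O + O') :=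
  fun y => (hO y).add_right (hO' y)

/-- **Gauge-invariant operators preserve the Gauss law**: no entries from Gauss-law states to
non-Gauss-law states. Bietenholz–Wiese (2025) §11.9. [folklore] -/
theorem IsGaugeInvariant.apply_eq_zero {ρ : FermionTorus 2 L → ℤ}
    {O : Matrix (Index L M) (Index L M) ℂ} (hO : IsGaugeInvariant ρ O) {i j : Index L M}
    (hi : ¬ IsGaussLaw L M ρ i) (hj : IsGaussLaw L M ρ j) : O i j = 0 := by
  by_contra h0
  exact hi fun y => by rw [isGaugeInvariant_iff_hasShift.1 hO y i j h0, hj y, zero_add]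

end Gauge

/-! ### Compression to the physical block -/

section Phys

variable {L M : ℕ} [NeZero L]

/-- The *compression* `Oₚ` of an operator to the physical block (Gauss law for `ρ` and
`2S^z = 0`): the submatrix on `{ik // IsPhysical ρ ik}`, exactly as `gaugedHubbardTorusPhys`
compresses `H_e`. Bietenholz–Wiese (2025) §11.9 eqs. (11.71)–(11.72). [folklore] -/
def toPhys (ρ : FermionTorus 2 L → ℤ) (O : Matrix (Index L M) (Index L M) ℂ) :
    Matrix {ik : Index L M // IsPhysical L M ρ ik} {ik : Index L M // IsPhysical L M ρ ik} ℂ :=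
  O.submatrix Subtype.val Subtype.val

variable (ρ : FermionTorus 2 L → ℤ)

/-- Entries of the compression. [folklore] -/
@[simp] theorem toPhys_apply (O : Matrix (Index L M) (Index L M) ℂ)
    (i j : {ik : Index L M // IsPhysical L M ρ ik}) : toPhys ρ O i j = O i.1 j.1 := rfl

/-- The physical gauged Hubbard torus is the compression of `H_e`. [folklore] -/
theorem toPhys_gaugedHubbardTorus (U e : ℝ) :
    toPhys ρ (gaugedHubbardTorus L U e M) = gaugedHubbardTorusPhys L U e M ρ := rfl

/-- Compression of `1`. [folklore] -/
@[simp] theorem toPhys_one : toPhys ρ (1 : Matrix (Index L M) (Index L M) ℂ) = 1 :=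
  submatrix_one _ Subtype.val_injective

/-- Compression is additive. [folklore] -/
theorem toPhys_add (O O' : Matrix (Index L M) (Index L M) ℂ) :
    toPhys ρ (O + O') = toPhys ρ O + toPhys ρ O' := rfl

/-- Compression commutes with scalars. [folklore] -/
theorem toPhys_smul (c : ℂ) (O : Matrix (Index L M) (Index L M) ℂ) :
    toPhys ρ (c • O) = c • toPhys ρ O := rfl

/-- Compression commutes with adjoints. [folklore] -/
theorem toPhys_conjTranspose (O : Matrix (Index L M) (Index L M) ℂ) :
    toPhys ρ Oᴴ = (toPhys ρ O)ᴴ := rfl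

/-- **Compression is multiplicative against block-preserving operators**: if `O'` has no entries
from physical to non-physical basis states then `(O O')ₚ = Oₚ O'ₚ` (e.g. `O' = H_e`,
`gaugedHubbardTorusWith_apply_eq_zero_of_not_isPhysical`). [folklore] -/
theorem toPhys_mul_of_apply_eq_zero (O O' : Matrix (Index L M) (Index L M) ℂ)
    (h : ∀ i j, ¬ IsPhysical L M ρ i → IsPhysical L M ρ j → O' i j = 0) :
    toPhys ρ (O * O') = toPhys ρ O * toPhys ρ O' := by
  ext p q
  simp only [toPhys_apply, Matrix.mul_apply]
  have hvan : ∀ k ∈ (univ : Finset (Index L M)), k ∉ univ.filter (IsPhysical L M ρ) →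
      O p.1 k * O' k q.1 = 0 := fun k _ hk => by
    rw [h k q.1 (by simpa using hk) q.2, mul_zero]
  rw [← Finset.sum_subset (subset_univ _) hvan,
    Finset.sum_subtype (p := IsPhysical L M ρ) (univ.filter (IsPhysical L M ρ)) (fun k => by simp)]

/-- **Compression is a contraction**: `‖Oₚ‖ ≤ ‖O‖` (operator norms); `Oₚ = E O Eᴴ` for the
coordinate isometry `E`. [folklore] -/
theorem norm_toPhys_le (O : Matrix (Index L M) (Index L M) ℂ) : ‖toPhys ρ O‖ ≤ ‖O‖ := by
  set E : Matrix {ik : Index L M // IsPhysical L M ρ ik} (Index L M) ℂ :=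
    (1 : Matrix (Index L M) (Index L M) ℂ).submatrix Subtype.val id with hE
  have hEO : toPhys ρ O = E * O * Eᴴ := by
    ext p q
    simp [toPhys, hE, Matrix.mul_apply, one_apply, Finset.sum_ite_eq', Finset.sum_ite_eq]
  have hEE : E * Eᴴ = 1 := by
    ext p q
    simp only [hE, Matrix.mul_apply, submatrix_apply, id, conjTranspose_apply, one_apply]
    simp [eq_comm, Subtype.val_inj]
  have h1 : ‖(1 : Matrix {ik : Index L M // IsPhysical L M ρ ik}
      {ik : Index L M // IsPhysical L M ρ ik} ℂ)‖ ≤ 1 := by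
    rw [Matrix.cstar_norm_def, map_one, ContinuousLinearMap.one_def]
    exact ContinuousLinearMap.norm_id_le
  have hEn : ‖Eᴴ‖ ≤ 1 := by
    have hsq : ‖Eᴴ‖ * ‖Eᴴ‖ ≤ 1 := by
      rw [← l2_opNorm_conjTranspose_mul_self, conjTranspose_conjTranspose, hEE]
      exact h1
    nlinarith [norm_nonneg Eᴴ]
  have hEn' : ‖E‖ ≤ 1 := by rwa [l2_opNorm_conjTranspose] at hEn
  calc ‖toPhys ρ O‖ = ‖E * O * Eᴴ‖ := by rw [hEO]
    _ ≤ ‖E * O‖ * ‖Eᴴ‖ := l2_opNorm_mul _ _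
    _ ≤ ‖E‖ * ‖O‖ * ‖Eᴴ‖ := mul_le_mul_of_nonneg_right (l2_opNorm_mul _ _) (norm_nonneg _)
    _ ≤ 1 * ‖O‖ * 1 := by gcongr
    _ = ‖O‖ := by ring

end Phys

/-! ### LTQO for the physical gauged Hubbard torus -/

section LTQO

/-- **Local topological quantum order (local indistinguishability) of the `m`-cluster of the
physical gauged Hubbard torus, with rate `Δ`.** For every site `x`, radii `r, ℓ` with
`2 (r + ℓ) < L` (the ball of radius `r + ℓ` does not wrap around the torus) and every
GAUGE-INVARIANT operator `O` supported in the ball `siteBall x r` (even fermion polynomials over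
the ball ⊗ link operators of its bonds), there is a scalar `c` with
`‖P Oₚ P − c • P‖ ≤ ‖O‖ Δ ℓ`, where `Oₚ = toPhys ρ O` is the compression to the physical block and
`P = clusterProj (gaugedHubbardTorusPhys L U e M ρ) m` the projection onto its `m` lowest
eigenvectors. This is condition TQO-1 of Bravyi–Hastings–Michalakis ("`P O_A P = c P`",
BHM10 §2.2; Bravyi–Hastings 2011 §2) for the degenerate cluster, with an explicit error `Δ ℓ`
in place of exact equality and the room `ℓ` in place of the cut-off `L*`, in the norm form of
Michalakis–Zwolak's Local-TQO (MZ13 §4.1 Def. 4, whose scalar `tr (P O)/tr P` is replaced by an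
existential one, cf. `HasLTQO.of_ltqoConst`), restricted to even (NSY18 §6) and gauge-invariant
(NSY24, after Assumption 2.3) observables. [folklore] -/
def HasLTQO (L : ℕ) [NeZero L] (U e : ℝ) (M : ℕ) (ρ : FermionTorus 2 L → ℤ) (m : ℕ)
    (Δ : ℕ → ℝ) : Prop :=
  ∀ (x : FermionTorus 2 L) (r ℓ : ℕ) (O : Matrix (Index L M) (Index L M) ℂ),
    IsSupportedOn O (siteBall x r) → IsGaugeInvariant ρ O → 2 * (r + ℓ) < L →
      ∃ c : ℂ, ‖(gaugedHubbardTorusPhys L U e M ρ).clusterProj m * toPhys ρ O *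
            (gaugedHubbardTorusPhys L U e M ρ).clusterProj m -
          c • (gaugedHubbardTorusPhys L U e M ρ).clusterProj m‖ ≤ ‖O‖ * Δ ℓ

variable {L : ℕ} [NeZero L] {U e : ℝ} {M : ℕ} {ρ : FermionTorus 2 L → ℤ} {m : ℕ} {Δ : ℕ → ℝ}

/-- LTQO is monotone in the rate: a larger rate is a weaker requirement. MZ13 §4.1. [folklore] -/
theorem HasLTQO.mono {Δ' : ℕ → ℝ} (h : HasLTQO L U e M ρ m Δ) (hle : Δ ≤ Δ') :
    HasLTQO L U e M ρ m Δ' := fun x r ℓ O hO hG hL => by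
  obtain ⟨c, hc⟩ := h x r ℓ O hO hG hL
  exact ⟨c, hc.trans (mul_le_mul_of_nonneg_left (hle ℓ) (norm_nonneg O))⟩

/-- The Michalakis–Zwolak form (scalar `c(O) = tr (P Oₚ) / tr P`, `ltqoConst`) implies the
existential form. MZ13 §4.1 Def. 4. [folklore] -/
theorem HasLTQO.of_ltqoConst
    (h : ∀ (x : FermionTorus 2 L) (r ℓ : ℕ) (O : Matrix (Index L M) (Index L M) ℂ),
      IsSupportedOn O (siteBall x r) → IsGaugeInvariant ρ O → 2 * (r + ℓ) < L →
        ‖(gaugedHubbardTorusPhys L U e M ρ).clusterProj m * toPhys ρ O *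
              (gaugedHubbardTorusPhys L U e M ρ).clusterProj m -
            ltqoConst ((gaugedHubbardTorusPhys L U e M ρ).clusterProj m) (toPhys ρ O) •
              (gaugedHubbardTorusPhys L U e M ρ).clusterProj m‖ ≤ ‖O‖ * Δ ℓ) :
    HasLTQO L U e M ρ m Δ :=
  fun x r ℓ O hO hG hL => ⟨_, h x r ℓ O hO hG hL⟩

/-- **Non-vacuity / normalisation**: every physical gauged Hubbard torus has LTQO with the
trivial rate `Δ ≡ 1` (take `c = 0`: `‖P Oₚ P‖ ≤ ‖P‖ ‖Oₚ‖ ‖P‖ ≤ ‖O‖`); the content of the notion is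
in decaying rates. [folklore] -/
theorem hasLTQO_const_one : HasLTQO L U e M ρ m (fun _ => 1) := by
  intro x r ℓ O hO hG hL
  refine ⟨0, ?_⟩
  have hA := isHermitian_gaugedHubbardTorusPhys L M U e ρ
  have hP : ‖(gaugedHubbardTorusPhys L U e M ρ).clusterProj m‖ ≤ 1 := by
    rw [Matrix.clusterProj_eq hA]
    exact hA.norm_clusterProj_le_one m
  have hOp := norm_toPhys_le ρ O
  rw [zero_smul, sub_zero, mul_one]
  calc _ ≤ ‖(gaugedHubbardTorusPhys L U e M ρ).clusterProj m * toPhys ρ O‖ *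
        ‖(gaugedHubbardTorusPhys L U e M ρ).clusterProj m‖ := norm_mul_le _ _
    _ ≤ ‖(gaugedHubbardTorusPhys L U e M ρ).clusterProj m‖ * ‖toPhys ρ O‖ *
        ‖(gaugedHubbardTorusPhys L U e M ρ).clusterProj m‖ :=
        mul_le_mul_of_nonneg_right (norm_mul_le _ _) (norm_nonneg _)
    _ ≤ 1 * ‖O‖ * 1 := by gcongr
    _ = ‖O‖ := by ring

end LTQO

end GaugedHubbard

end Literature.MathematicalPhysics.QuantumLattice
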